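import Summits.CriticalPhenomena.CardyFormulaZ2.Theorems.CardyMeckeFlipMeckeRigidityDilationAPI

/-!
# Covariance of pivotality under dilations

Route `Summits/CriticalPhenomena/CardyFormulaZ2/Theses/CardyMeckeFlip`, crux `MeckeRigidity`
(item stmt-CriticalPhenomena-14826), line `registered`, stub `isPivotalAt_dilate_iff`:
`x` is pivotal for `Q` in `S ∈ ℋ_ℂ` iff `t x` is pivotal for `S_t Q` in `S_t S` (`t > 0`).
Carriers and sides of dilated quads are images under `w ↦ t w`, balls scale
(`B(t x, ε) = t · B(x, ε / t)`), and the sub-quad quantifiers are reparametrised by `S_t`.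
-/

noncomputable section
open MeasureTheory Set Metric Filter Topology
open Literature.Probability.Percolation Literature.Probability.Percolation.QuadCrossing
namespace Summit.CriticalPhenomena.CardyFormulaZ2.Theorems.CardyMeckeFlip

/-- Balls scale under `w ↦ s w` (`s > 0`): `B(s x, ε) = s · B(x, ε / s)`. [folklore] -/
theorem ball_mul_eq_image_ball {s : ℝ} (hs : 0 < s) (x : ℂ) (ε : ℝ) :
    Metric.ball ((s : ℂ) * x) ε = (fun w : ℂ => (s : ℂ) * w) '' Metric.ball x (ε / s) := by
  have hs0 : (s : ℂ) ≠ 0 := Complex.ofReal_ne_zero.mpr hs.ne'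
  ext w
  simp only [Metric.mem_ball, Set.mem_image, dist_eq_norm]
  constructor
  · intro hw
    refine ⟨(s : ℂ)⁻¹ * w, ?_, mul_inv_cancel_left₀ hs0 w⟩
    rw [show (s : ℂ)⁻¹ * w - x = (s : ℂ)⁻¹ * (w - (s : ℂ) * x) by
      rw [mul_sub, inv_mul_cancel_left₀ hs0]]
    rw [norm_mul, norm_inv, Complex.norm_of_nonneg hs.le, lt_div_iff₀' hs,
      mul_inv_cancel_left₀ hs.ne']
    exact hw
  · rintro ⟨y, hy, rfl⟩
    rw [← mul_sub, norm_mul, Complex.norm_of_nonneg hs.le]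
    exact (lt_div_iff₀' hs).mp hy

/-- `S_s Q ∈ S_s S ↔ Q ∈ S`. [folklore] -/
theorem quad_dilate_mem_quadConfig_dilate_iff (s : ℝ) (hs : s ≠ 0) (S : QuadConfig (univ : Set ℂ))
    (Q : Quad (univ : Set ℂ)) : Q.dilate s hs ∈ QuadConfig.dilate s hs S ↔ Q ∈ S := by
  rw [mem_quadConfig_dilate_iff, quad_dilate_inv_dilate]

/-- Pivotality is transported by dilations (one direction, `s > 0`): if `x` is pivotal for `Q`
in `S`, then `s x` is pivotal for `S_s Q` in `S_s S`. [folklore] -/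
theorem isPivotalAt_dilate_of_isPivotalAt {s : ℝ} (hs : 0 < s) (hs0 : s ≠ 0)
    {S : QuadConfig (univ : Set ℂ)} {x : ℂ} {Q : Quad (univ : Set ℂ)} (h : S.IsPivotalAt x Q) :
    (QuadConfig.dilate s hs0 S).IsPivotalAt ((s : ℂ) * x) (Q.dilate s hs0) := by
  have hm : Function.Injective (fun w : ℂ => (s : ℂ) * w) :=
    mul_right_injective₀ (Complex.ofReal_ne_zero.mpr hs0)
  rw [QuadConfig.isPivotalAt_iff] at h ⊢
  rcases h with ⟨hQ, hopen⟩ | ⟨hQ, hclosed⟩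
  · refine Or.inl ⟨(quad_dilate_mem_quadConfig_dilate_iff s hs0 S Q).mpr hQ,
      fun ε hε Q'' hcar h0 h2 => ?_⟩
    obtain ⟨Q', rfl⟩ : ∃ Q' : Quad (univ : Set ℂ), Q'.dilate s hs0 = Q'' :=
      ⟨Q''.dilate s⁻¹ (inv_ne_zero hs0), quad_dilate_dilate_inv s hs0 Q''⟩
    rw [quad_dilate_mem_quadConfig_dilate_iff]
    rw [carrier_quad_dilate, carrier_quad_dilate, ball_mul_eq_image_ball hs,
      ← Set.image_sdiff hm, Set.image_subset_image_iff hm] at hcar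
    rw [side_quad_dilate, side_quad_dilate, Set.image_subset_image_iff hm] at h0 h2
    exact hopen (ε / s) (div_pos hε hs) Q' hcar h0 h2
  · refine Or.inr ⟨fun h => hQ ((quad_dilate_mem_quadConfig_dilate_iff s hs0 S Q).mp h),
      fun ε hε => ?_⟩
    obtain ⟨Q₁, Q₂, h₁, h₂, hc₁, hc₂, h₁₀, h₁₂, h₂₀, h₂₂⟩ := hclosed (ε / s) (div_pos hε hs)
    refine ⟨Q₁.dilate s hs0, Q₂.dilate s hs0, (quad_dilate_mem_quadConfig_dilate_iff s hs0 S Q₁).mpr h₁,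
      (quad_dilate_mem_quadConfig_dilate_iff s hs0 S Q₂).mpr h₂, ?_, ?_, ?_, ?_, ?_, ?_⟩
    · rw [carrier_quad_dilate, carrier_quad_dilate]; exact Set.image_mono hc₁
    · rw [carrier_quad_dilate, carrier_quad_dilate]; exact Set.image_mono hc₂
    · rw [side_quad_dilate, side_quad_dilate]; exact Set.image_mono h₁₀
    · rw [side_quad_dilate, ball_mul_eq_image_ball hs]; exact Set.image_mono h₁₂
    · rw [side_quad_dilate, ball_mul_eq_image_ball hs]; exact Set.image_mono h₂₀
    · rw [side_quad_dilate, side_quad_dilate]; exact Set.image_mono h₂₂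

/-- **Covariance of pivotality under dilations** (registered sub-goal `isPivotalAt_dilate_iff` of
item stmt-CriticalPhenomena-14826): for `t > 0`, `t x` is pivotal for `S_t Q` in `S_t S` iff `x` is
pivotal for `Q` in `S`; the converse direction is the direct one applied to `S_{t⁻¹}`. [folklore] -/
theorem isPivotalAt_dilate_iff : ∀ (t : ℝ) (ht : 0 < t) (S : QuadConfig (Set.univ : Set ℂ)) (x : ℂ) (Q : Quad (Set.univ : Set ℂ)), (QuadConfig.dilate t ht.ne' S).IsPivotalAt ((t : ℂ) * x) (Quad.dilate t ht.ne' Q) ↔ S.IsPivotalAt x Q := by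
  intro t ht S x Q
  refine ⟨fun h => ?_, fun h => isPivotalAt_dilate_of_isPivotalAt ht ht.ne' h⟩
  have h' := isPivotalAt_dilate_of_isPivotalAt (inv_pos.mpr ht) (inv_ne_zero ht.ne') h
  rwa [quadConfig_dilate_inv_dilate, quad_dilate_inv_dilate, Complex.ofReal_inv,
    inv_mul_cancel_left₀ (Complex.ofReal_ne_zero.mpr ht.ne')] at h'

end Summit.CriticalPhenomena.CardyFormulaZ2.Theorems.CardyMeckeFlip

end
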